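import Mathlib.NumberTheory.NumberField.CMField
import Mathlib.NumberTheory.Real.Irrational
import Mathlib.FieldTheory.PrimitiveElement
import Literature.NumberTheory.NumberFields.PositiveInvolutionCM
import HarnessLib

/-!
# The quadratic-twist composita `τ(L)(√-p) ⊂ ℂ` of a CM field: number-field bookkeeping for the K-twist route to
# Deligne's canonical model of the compact unitary Shimura surface ([Deligne 1979] Prop. 2.3.10, type A)

Topic `NumberTheory/NumberFields`; namespace `Literature.NumberTheory.NumberFields`. THEOREMS ONLY (no definition, no
named fact, no instance, no `sorry`).

For a number field `L` with a complex embedding `τ : L →+* ℂ` and a square root `r ∈ ℂ` of `-p` (`p` a positive natural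
number) put `E_r := τ(L) ⊔ ℚ(r) ⊂ ℂ` (spelled `τ.toRatAlgHom.fieldRange ⊔ IntermediateField.adjoin ℚ {r}` throughout —
the right-hand side of `traceField_quadraticTwistCMType_le` of `…ComplexMultiplication.CMTypeQuadraticTwist`).  This file
proves the four facts about these composita that [Deligne1979ShimuraVarieties] Prop. 2.3.10 (proof for type `A`,
PDF p. 33 of Milne's translation: «let `K` be a quadratic totally imaginary extension of `F` … `E(G₁,X₁) = E(G,X)·E(K,h_T)`»)
uses when it is run with TWO auxiliary imaginary quadratic fields `ℚ(√-p)`, `ℚ(√-q)` instead of Deligne's infinite supply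
(cell hodgecm-mathlib, hDel K-TWIST ruling 2026-08-28: descent to `τ(L) = E_{r} ∩ E_{r'}` by [Deligne1971TravauxShimura] 5.10):
* §1 `E_r` is a number field containing `τ(L)` and `r` (`finiteDimensional_fieldRange_sup_adjoin`, `apply_mem_…`,
  `exists_sq_root_mem_…`);
* §2 `E_r` is a CM field when `L` is (`isCMField_fieldRange_sup_adjoin`: complex conjugation restricts to `E_r` and is
  complex conjugation under EVERY embedding of `E_r`, [Shimura1998] §18.2 Lemma (i) = tree
  `IsCMField.of_forall_isConj_of_ne_one`);
* §3 `E_r ∩ E_{r'} ⊆ τ(L)` as soon as `r' ∉ E_r` (`inf_fieldRange_sup_adjoin_subset_range`: `E_{r'} = τ(L) ⊕ τ(L)·r'`);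
* §4 such a pair exists for every `(L, τ)`: primes `p ≠ q` and square roots `r, r'` of `-p, -q` with `r' ∉ E_r`
  (`exists_prime_sq_roots_not_mem`: a number field has finitely many subfields — Steinitz, Mathlib
  `Field.finite_intermediateField_of_exists_primitive_element` — while the fields `ℚ(√-q)`, `q` prime, are pairwise distinct).

## References
* [Deligne1979ShimuraVarieties] P. Deligne, *Variétés de Shimura*, PSPM XXXIII.2 (1979), 2.3.9–2.3.10 (PDF pp. 32–33 of
  Milne's translation `paper:url-7710442a1cf6`).
* [Deligne1971TravauxShimura] P. Deligne, *Travaux de Shimura*, Sém. Bourbaki 389 (1971), 5.10 (p. 158).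
* [Shimura1998] G. Shimura, *Abelian varieties with complex multiplication and modular functions* (1998), §18.2 Lemma (i).
-/

set_option autoImplicit false

noncomputable section

namespace Literature.NumberTheory.NumberFields

open NumberField NumberField.ComplexEmbedding Polynomial
open scoped ComplexConjugate IntermediateField

variable {L : Type} [Field L] [NumberField L] (τ : L →+* ℂ)

/-! ### §1. `E_r = τ(L)(r)` is a number field containing `τ(L)` and `r` -/

/-- **`τ(L) ≤ E_r = τ(L)·ℚ(r)`** — Deligne's `E(G₁,X₁) = E(G,X)·E(K,h_T) ⊇ E(G,X)` read for `E(G,X) = τ(L)`, `K`-part `ℚ(√-p)`.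
[cite: Deligne1979ShimuraVarieties, 2.3.10 (i) (PDF p. 32 of Milne's translation)] -/
theorem fieldRange_le_fieldRange_sup_adjoin (r : ℂ) :
    τ.toRatAlgHom.fieldRange ≤ τ.toRatAlgHom.fieldRange ⊔ IntermediateField.adjoin ℚ {r} :=
  le_sup_left

/-- **`τ(x) ∈ E_r`** (`E(G,X) = τ(L) ⊆ E(G₁,X₁)`). [cite: Deligne1979ShimuraVarieties, 2.3.10 (i) (PDF p. 32 of Milne's translation)] -/
theorem apply_mem_fieldRange_sup_adjoin (r : ℂ) (x : L) :
    τ x ∈ τ.toRatAlgHom.fieldRange ⊔ IntermediateField.adjoin ℚ {r} :=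
  fieldRange_le_fieldRange_sup_adjoin τ r (AlgHom.mem_fieldRange.2 ⟨x, rfl⟩)

/-- **`r ∈ E_r`** (the auxiliary quadratic field `E(K,h_T) ∋ √-p` lies in `E(G₁,X₁)`).
[cite: Deligne1979ShimuraVarieties, 2.3.9–2.3.10 (PDF pp. 32–33 of Milne's translation)] -/
theorem mem_fieldRange_sup_adjoin_self (r : ℂ) :
    r ∈ τ.toRatAlgHom.fieldRange ⊔ IntermediateField.adjoin ℚ {r} :=
  (le_sup_right : IntermediateField.adjoin ℚ {r} ≤ _) (IntermediateField.mem_adjoin_simple_self ℚ r)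

/-- The elements of `τ(L)` are the values of `τ`. [folklore] -/
private theorem mem_fieldRange_iff (z : ℂ) : z ∈ τ.toRatAlgHom.fieldRange ↔ z ∈ Set.range τ := by
  rw [AlgHom.mem_fieldRange]
  rfl

/-- `τ(L)` is finite over `ℚ`. [folklore] -/
private theorem finiteDimensional_fieldRange : FiniteDimensional ℚ ↥τ.toRatAlgHom.fieldRange :=
  LinearEquiv.finiteDimensional (AlgEquiv.ofInjectiveField τ.toRatAlgHom).toLinearEquiv

/-- A square root of `-p` is integral over `ℚ`. [folklore] -/
private theorem isIntegral_of_mul_self_eq_neg {r : ℂ} {p : ℕ} (hr : r * r = -(p : ℂ)) : IsIntegral ℚ r := by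
  refine ⟨X ^ 2 + C (p : ℚ), monic_X_pow_add_C _ two_ne_zero, ?_⟩
  simp [sq, hr]

/-- **`E_r` is finite over `ℚ`** (compositum of two finite extensions, Mathlib `IntermediateField.finiteDimensional_sup`) —
the reflex field `E(G₁,X₁) = E(G,X)·E(K,h_T)` of the twisted datum is a number field.
[cite: Deligne1979ShimuraVarieties, 2.3.10 (i) (PDF p. 32 of Milne's translation)] -/
theorem finiteDimensional_fieldRange_sup_adjoin {r : ℂ} {p : ℕ} (hr : r * r = -(p : ℂ)) :
    FiniteDimensional ℚ ↥(τ.toRatAlgHom.fieldRange ⊔ IntermediateField.adjoin ℚ {r}) := by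
  haveI := finiteDimensional_fieldRange τ
  haveI : FiniteDimensional ℚ ↥(IntermediateField.adjoin ℚ {r}) :=
    IntermediateField.adjoin.finiteDimensional (isIntegral_of_mul_self_eq_neg hr)
  exact IntermediateField.finiteDimensional_sup _ _

/-- **`E_r` is a number field** (bookkeeping for `𝔸_{E_r,f}`; a `theorem`, not an instance — typer lint).
[cite: Deligne1979ShimuraVarieties, 2.3.10 (i) (PDF p. 32 of Milne's translation)] -/
theorem numberField_fieldRange_sup_adjoin {r : ℂ} {p : ℕ} (hr : r * r = -(p : ℂ)) :
    NumberField ↥(τ.toRatAlgHom.fieldRange ⊔ IntermediateField.adjoin ℚ {r}) := by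
  haveI := finiteDimensional_fieldRange_sup_adjoin τ hr
  exact ⟨⟩

/-- **`E_r` contains a square root `w` of `-p` lying over `r`** — so `E_r ⊇ τ(L)` is (an image of) Deligne's `K = F(√-p)`-extended
field `L·K = L(√-p)`, «`K` a quadratic totally imaginary extension of `F`».
[cite: Deligne1979ShimuraVarieties, 2.3.9 (PDF p. 32 of Milne's translation)] -/
theorem exists_sq_root_mem_fieldRange_sup_adjoin {r : ℂ} {p : ℕ} (hr : r * r = -(p : ℂ)) :
    ∃ w : ↥(τ.toRatAlgHom.fieldRange ⊔ IntermediateField.adjoin ℚ {r}),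
      (w : ℂ) = r ∧ w * w = -(p : ↥(τ.toRatAlgHom.fieldRange ⊔ IntermediateField.adjoin ℚ {r})) :=
  ⟨⟨r, mem_fieldRange_sup_adjoin_self τ r⟩, rfl, Subtype.ext (by simpa using hr)⟩


/-! ### §2. `E_r` is a CM field (for `L` CM) -/

/-- A square root of `-p`, `p > 0`, is purely imaginary: `conj r = -r`. [folklore] -/
private theorem conj_eq_neg_of_mul_self_eq_neg {r : ℂ} {p : ℕ} (hp : 0 < p) (hr : r * r = -(p : ℂ)) : conj r = -r := by
  have him : r.re * r.im = 0 := by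
    have h := congrArg Complex.im hr
    simp only [Complex.mul_im, Complex.neg_im, Complex.natCast_im, neg_zero] at h
    linarith
  have hre : r.re * r.re - r.im * r.im = -(p : ℝ) := by
    have h := congrArg Complex.re hr
    simpa [Complex.mul_re] using h
  have hre0 : r.re = 0 := by
    rcases mul_eq_zero.1 him with h | h
    · exact h
    · rw [h, mul_zero, sub_zero] at hre
      have hp' : (0 : ℝ) < p := by exact_mod_cast hp
      nlinarith [mul_self_nonneg r.re]
  apply Complex.ext <;> simp [hre0]

/-- A square root of `-p`, `p > 0`, is non-zero. [folklore] -/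
private theorem ne_zero_of_mul_self_eq_neg {r : ℂ} {p : ℕ} (hp : 0 < p) (hr : r * r = -(p : ℂ)) : r ≠ 0 := by
  rintro rfl
  have h : (p : ℂ) = 0 := by simpa using hr.symm
  exact (Nat.pos_iff_ne_zero.1 hp) (by exact_mod_cast h)

/-- `τ(L) = ℚ(τ(L))` as intermediate fields of `ℂ/ℚ`. [folklore] -/
private theorem fieldRange_eq_adjoin_range : τ.toRatAlgHom.fieldRange = IntermediateField.adjoin ℚ (Set.range τ) := by
  refine le_antisymm (fun z hz => ?_) (IntermediateField.adjoin_le_iff.2 fun z hz => ?_)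
  · obtain ⟨x, rfl⟩ := (mem_fieldRange_iff τ z).1 hz
    exact IntermediateField.subset_adjoin ℚ _ ⟨x, rfl⟩
  · exact (mem_fieldRange_iff τ z).2 hz

/-- `E_r = ℚ(τ(L) ∪ {r})`. [folklore] -/
private theorem fieldRange_sup_adjoin_eq_adjoin_union (r : ℂ) :
    τ.toRatAlgHom.fieldRange ⊔ IntermediateField.adjoin ℚ {r} = IntermediateField.adjoin ℚ (Set.range τ ∪ {r}) := by
  rw [IntermediateField.adjoin_union, fieldRange_eq_adjoin_range]

/-- **`ℚ(τ(L) ∪ {r})` is stable under complex conjugation** when `L` is CM (`conj ∘ τ = τ ∘ c_L`) and `conj r = -r`.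
[cite: Shimura1998, §18.2 Lemma (i) (p. 127)] -/
private theorem conj_mem_adjoin_union [IsCMField L] {r : ℂ} {p : ℕ} (hp : 0 < p) (hr : r * r = -(p : ℂ)) {z : ℂ}
    (hz : z ∈ IntermediateField.adjoin ℚ (Set.range τ ∪ {r})) :
    conj z ∈ IntermediateField.adjoin ℚ (Set.range τ ∪ {r}) := by
  induction hz using IntermediateField.adjoin_induction with
  | mem x hx =>
    rcases hx with ⟨y, rfl⟩ | hx
    · rw [← IsCMField.complexEmbedding_complexConj L τ y]
      exact IntermediateField.subset_adjoin ℚ _ (Or.inl ⟨_, rfl⟩)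
    · rw [Set.mem_singleton_iff] at hx
      subst hx
      rw [conj_eq_neg_of_mul_self_eq_neg hp hr]
      exact neg_mem (IntermediateField.subset_adjoin ℚ _ (Or.inr rfl))
  | algebraMap q =>
    rw [show conj (algebraMap ℚ ℂ q) = algebraMap ℚ ℂ q from by simp]
    exact IntermediateField.algebraMap_mem _ q
  | add x y _ _ hx hy => rw [map_add]; exact add_mem hx hy
  | inv x _ hx => rw [map_inv₀]; exact inv_mem hx
  | mul x y _ _ hx hy => rw [map_mul]; exact mul_mem hx hy

/-- **Complex conjugation restricts to a `ℚ`-automorphism `σ ≠ 1` of `ℚ(τ(L) ∪ {r})` which is complex conjugation under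
EVERY complex embedding** — Shimura's criterion [Shimura1998] §18.2 Lemma (i) checked on the generators `τ(L)` (where it
is the CM property of `L`) and `r` (where `φ(r)² = -p` forces `conj φ(r) = -φ(r) = φ(σ r)`).
[cite: Shimura1998, §18.2 Lemma (i) (p. 127)] -/
private theorem exists_isConj_adjoin_union [IsCMField L] {r : ℂ} {p : ℕ} (hp : 0 < p) (hr : r * r = -(p : ℂ)) :
    ∃ σ : ↥(IntermediateField.adjoin ℚ (Set.range τ ∪ {r})) ≃ₐ[ℚ] ↥(IntermediateField.adjoin ℚ (Set.range τ ∪ {r})),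
      σ ≠ 1 ∧ ∀ φ : ↥(IntermediateField.adjoin ℚ (Set.range τ ∪ {r})) →+* ℂ, IsConj φ σ := by
  set E := IntermediateField.adjoin ℚ (Set.range τ ∪ {r}) with hE
  have hmem : ∀ z : ↥E, conj (z : ℂ) ∈ E := fun z => conj_mem_adjoin_union τ hp hr z.2
  let σ : ↥E ≃ₐ[ℚ] ↥E :=
    { toFun := fun z => ⟨conj (z : ℂ), hmem z⟩
      invFun := fun z => ⟨conj (z : ℂ), hmem z⟩
      left_inv := fun z => Subtype.ext (Complex.conj_conj _)
      right_inv := fun z => Subtype.ext (Complex.conj_conj _)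
      map_mul' := fun x y => Subtype.ext (map_mul _ _ _)
      map_add' := fun x y => Subtype.ext (map_add _ _ _)
      commutes' := fun q => Subtype.ext (by simp) }
  have hσ : ∀ z : ↥E, ((σ z : ↥E) : ℂ) = conj (z : ℂ) := fun z => rfl
  have hrE : r ∈ E := IntermediateField.subset_adjoin ℚ _ (Or.inr rfl)
  refine ⟨σ, fun h1 => ?_, fun φ => ?_⟩
  · -- `σ r = -r ≠ r`
    have h := congrArg (fun z : ↥E => (z : ℂ)) (AlgEquiv.congr_fun h1 ⟨r, hrE⟩)
    simp only [AlgEquiv.one_apply] at h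
    rw [hσ, conj_eq_neg_of_mul_self_eq_neg hp hr] at h
    exact ne_zero_of_mul_self_eq_neg hp hr (neg_eq_self.1 h)
  · -- `conj ∘ φ = φ ∘ σ`: check on generators
    refine RingHom.ext fun z => ?_
    change conj (φ z) = φ (σ z)
    obtain ⟨z, hz⟩ := z
    induction hz using IntermediateField.adjoin_induction with
    | mem x hx =>
      rcases hx with ⟨y, rfl⟩ | hx
      · -- `x = τ y`: the CM property of `L` under the embedding `φ ∘ τ`
        let τE : L →+* ↥E :=
          { toFun := fun y => ⟨τ y, IntermediateField.subset_adjoin ℚ _ (Or.inl ⟨y, rfl⟩)⟩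
            map_one' := Subtype.ext (map_one τ)
            map_mul' := fun a b => Subtype.ext (map_mul τ a b)
            map_zero' := Subtype.ext (map_zero τ)
            map_add' := fun a b => Subtype.ext (map_add τ a b) }
        have h := IsCMField.complexEmbedding_complexConj L (φ.comp τE) y
        have hστ : σ (τE y) = τE (IsCMField.complexConj L y) := Subtype.ext (by
          rw [hσ]
          change conj (τ y) = τ (IsCMField.complexConj L y)
          exact (IsCMField.complexEmbedding_complexConj L τ y).symm)
        change conj (φ (τE y)) = φ (σ (τE y))
        rw [hστ]
        exact h.symm
      · -- `x = r`: `φ(r)² = -p`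
        rw [Set.mem_singleton_iff] at hx
        subst hx
        have hρ : φ ⟨x, hrE⟩ * φ ⟨x, hrE⟩ = -(p : ℂ) := by
          rw [← map_mul]
          have : (⟨x, hrE⟩ : ↥E) * ⟨x, hrE⟩ = -(p : ↥E) := Subtype.ext (by simpa using hr)
          rw [this, map_neg, map_natCast]
        have hσr : σ ⟨x, hrE⟩ = -⟨x, hrE⟩ := Subtype.ext (by
          rw [hσ]; exact conj_eq_neg_of_mul_self_eq_neg hp hr)
        rw [conj_eq_neg_of_mul_self_eq_neg hp hρ, hσr, map_neg]
    | algebraMap q =>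
      have h1 : (⟨algebraMap ℚ ℂ q, IntermediateField.algebraMap_mem E q⟩ : ↥E) = algebraMap ℚ ↥E q := rfl
      rw [h1, AlgEquiv.commutes]
      change conj (φ.toRatAlgHom (algebraMap ℚ ↥E q)) = φ.toRatAlgHom (algebraMap ℚ ↥E q)
      rw [AlgHom.commutes]
      simp
    | add x y hx hy ihx ihy =>
      have h1 : (⟨x + y, add_mem hx hy⟩ : ↥E) = ⟨x, hx⟩ + ⟨y, hy⟩ := rfl
      rw [h1, map_add, map_add, map_add, map_add, ihx, ihy]
    | inv x hx ihx =>
      have h1 : (⟨x⁻¹, inv_mem hx⟩ : ↥E) = (⟨x, hx⟩ : ↥E)⁻¹ := rfl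
      rw [h1, map_inv₀, map_inv₀, map_inv₀, map_inv₀, ihx]
    | mul x y hx hy ihx ihy =>
      have h1 : (⟨x * y, mul_mem hx hy⟩ : ↥E) = ⟨x, hx⟩ * ⟨y, hy⟩ := rfl
      rw [h1, map_mul, map_mul, map_mul, map_mul, ihx, ihy]

/-- **`E_r = τ(L)(r)` is a CM field** for `L` CM and `r² = -p < 0` (Shimura's criterion, tree
`IsCMField.of_forall_isConj_of_ne_one`). [cite: Shimura1998, §18.2 Lemma (i) (p. 127)]
[cite: Deligne1979ShimuraVarieties, 2.3.9 («`K` a quadratic totally imaginary extension»)] -/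
theorem isCMField_fieldRange_sup_adjoin [IsCMField L] {r : ℂ} {p : ℕ} (hp : 0 < p) (hr : r * r = -(p : ℂ)) :
    IsCMField ↥(τ.toRatAlgHom.fieldRange ⊔ IntermediateField.adjoin ℚ {r}) := by
  haveI := numberField_fieldRange_sup_adjoin τ hr
  rw [fieldRange_sup_adjoin_eq_adjoin_union] at this ⊢
  obtain ⟨σ, hσ1, hσ⟩ := exists_isConj_adjoin_union τ hp hr
  exact IsCMField.of_forall_isConj_of_ne_one hσ1 hσ


/-! ### §3. `E_r ∩ E_{r'} ⊆ τ(L)` when `r' ∉ E_r` -/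

/-- The minimal polynomial over any subfield `F ⊂ ℂ` of a square root `r` of `-q` has degree `≤ 2`. [folklore] -/
private theorem natDegree_minpoly_le_two (K : Type) [Field K] [Algebra K ℂ] {r : ℂ} {q : ℕ} (hr : r * r = -(q : ℂ)) :
    (minpoly K r).natDegree ≤ 2 := by
  have hmon : (X ^ 2 + C (q : K) : K[X]).Monic := monic_X_pow_add_C _ two_ne_zero
  have heval : aeval r (X ^ 2 + C (q : K) : K[X]) = 0 := by
    simp [sq, hr]
  have h := minpoly.min K r hmon heval
  calc (minpoly K r).natDegree ≤ (X ^ 2 + C (q : K) : K[X]).natDegree := natDegree_le_natDegree h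
    _ = 2 := natDegree_X_pow_add_C

/-- **`τ(L)(r') = τ(L) + τ(L)·r'`**: every element of `E_{r'}` is `a + b·r'` with `a, b ∈ τ(L)` (`r'² = -q ∈ ℚ`, so
`{1, r'}` spans `τ(L)(r')` over `τ(L)` — Mathlib `IntermediateField.adjoin.powerBasis`). [folklore] -/
private theorem exists_add_mul_eq_of_mem_fieldRange_sup_adjoin {r' : ℂ} {q : ℕ} (hr' : r' * r' = -(q : ℂ)) {z : ℂ}
    (hz : z ∈ τ.toRatAlgHom.fieldRange ⊔ IntermediateField.adjoin ℚ {r'}) :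
    ∃ a ∈ τ.toRatAlgHom.fieldRange, ∃ b ∈ τ.toRatAlgHom.fieldRange, z = a + b * r' := by
  set F := τ.toRatAlgHom.fieldRange with hF
  rw [← IntermediateField.restrictScalars_adjoin_eq_sup, IntermediateField.mem_restrictScalars] at hz
  have hint : IsIntegral ↥F r' := (isIntegral_of_mul_self_eq_neg hr').tower_top
  let pb := IntermediateField.adjoin.powerBasis hint
  have hdim : pb.dim ≤ 2 := by
    rw [IntermediateField.adjoin.powerBasis_dim]
    exact natDegree_minpoly_le_two (↥F) hr'
  obtain ⟨f, hfdeg, hf⟩ := pb.exists_eq_aeval ⟨z, hz⟩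
  have hf1 : f.natDegree ≤ 1 := by omega
  have hfe : f = C (f.coeff 1) * X + C (f.coeff 0) := eq_X_add_C_of_natDegree_le_one hf1
  refine ⟨(f.coeff 0 : ↥F), (f.coeff 0).2, (f.coeff 1 : ↥F), (f.coeff 1).2, ?_⟩
  -- read `⟨z, hz⟩ = aeval gen f` in `ℂ`: `z = aeval r' f = b·r' + a`
  have h1 := congrArg (IntermediateField.val (IntermediateField.adjoin (↥F) {r'})) hf
  rw [← Polynomial.aeval_algHom_apply] at h1
  have hgen : (IntermediateField.val (IntermediateField.adjoin (↥F) {r'})) pb.gen = r' := by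
    rw [IntermediateField.adjoin.powerBasis_gen]
    rfl
  rw [hgen, hfe] at h1
  have hz' : (IntermediateField.val (IntermediateField.adjoin (↥F) {r'})) ⟨z, hz⟩ = z := rfl
  rw [hz'] at h1
  rw [h1]
  simp only [map_add, map_mul, aeval_C, aeval_X]
  change (algebraMap ↥F ℂ (f.coeff 1)) * r' + algebraMap ↥F ℂ (f.coeff 0) = _
  rw [add_comm]
  rfl

/-- **`E_r ∩ E_{r'} ⊆ τ(L)` as soon as `r' ∉ E_r`** (element chase: `z = a + b·r' ∈ E_r` with `b ≠ 0` would put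
`r' = (z - a)/b` in `E_r`) — the census inclusion `E♯_p ⊓ E♯_q ≤ τ(L)` of the K-twist descent to the intersection
([Deligne1971TravauxShimura] 5.10) for the pair of twisted auxiliary data. [cite: Deligne1979ShimuraVarieties, 2.3.10 (i)]
[cite: Deligne1971TravauxShimura, 5.10 (p. 158)] -/
theorem inf_fieldRange_sup_adjoin_subset_range {r r' : ℂ} {q : ℕ} (hr' : r' * r' = -(q : ℂ))
    (h : r' ∉ τ.toRatAlgHom.fieldRange ⊔ IntermediateField.adjoin ℚ {r}) :
    (((τ.toRatAlgHom.fieldRange ⊔ IntermediateField.adjoin ℚ {r}) ⊓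
        (τ.toRatAlgHom.fieldRange ⊔ IntermediateField.adjoin ℚ {r'}) : IntermediateField ℚ ℂ) : Set ℂ) ⊆
      Set.range τ := by
  intro z hz
  rw [SetLike.mem_coe, IntermediateField.mem_inf] at hz
  obtain ⟨a, ha, b, hb, rfl⟩ := exists_add_mul_eq_of_mem_fieldRange_sup_adjoin τ hr' hz.2
  by_cases hb0 : b = 0
  · subst hb0
    rw [zero_mul, add_zero]
    exact (mem_fieldRange_iff τ a).1 ha
  · exfalso
    apply h
    have ha' : a ∈ τ.toRatAlgHom.fieldRange ⊔ IntermediateField.adjoin ℚ {r} := fieldRange_le_fieldRange_sup_adjoin τ r ha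
    have hb' : b ∈ τ.toRatAlgHom.fieldRange ⊔ IntermediateField.adjoin ℚ {r} := fieldRange_le_fieldRange_sup_adjoin τ r hb
    have hr'eq : r' = (a + b * r' - a) * b⁻¹ := by
      rw [add_sub_cancel_left, mul_comm b r', mul_inv_cancel_right₀ hb0]
    rw [hr'eq]
    exact mul_mem (sub_mem hz.1 ha') (inv_mem hb')


/-! ### §4. A twist pair exists: primes `p, q` and square roots `r, r'` of `-p, -q` with `r' ∉ E_r` -/

/-- `(i√q)² = -q`. [folklore] -/
private theorem I_mul_sqrt_mul_self (q : ℕ) :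
    (Complex.I * (Real.sqrt q : ℂ)) * (Complex.I * (Real.sqrt q : ℂ)) = -(q : ℂ) := by
  have h : ((Real.sqrt q : ℝ) : ℂ) * ((Real.sqrt q : ℝ) : ℂ) = (q : ℂ) := by
    rw [← Complex.ofReal_mul, Real.mul_self_sqrt (Nat.cast_nonneg q), Complex.ofReal_natCast]
  calc (Complex.I * (Real.sqrt q : ℂ)) * (Complex.I * (Real.sqrt q : ℂ))
      = (Complex.I * Complex.I) * (((Real.sqrt q : ℝ) : ℂ) * ((Real.sqrt q : ℝ) : ℂ)) := by ring
    _ = -(q : ℂ) := by rw [Complex.I_mul_I, h]; ring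

/-- `q·q'` is not a square for distinct primes `q, q'`. [folklore] -/
private theorem not_isSquare_mul_of_prime_ne {q q' : ℕ} (hq : q.Prime) (hq' : q'.Prime) (hne : q ≠ q') :
    ¬ IsSquare (q' * q) := by
  rintro ⟨m, hm⟩
  have hdvd : q ∣ m * m := ⟨q', by rw [← hm, mul_comm]⟩
  have hqm : q ∣ m := ((Nat.Prime.dvd_mul hq).1 hdvd).elim id id
  obtain ⟨k, rfl⟩ := hqm
  have hq'eq : q' = q * k * k := by
    have h2 : q' * q = (q * k * k) * q := by rw [hm]; ring
    exact Nat.eq_of_mul_eq_mul_right hq.pos h2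
  exact hne ((Nat.prime_dvd_prime_iff_eq hq hq').1 ⟨k * k, by rw [hq'eq]; ring⟩)

/-- **`i√q' ∉ ℚ(i√q)` for distinct primes `q ≠ q'`** (`i√q' = a + b·i√q` with `a, b ∈ ℚ` forces `a = 0` and
`√(q'q) = bq ∈ ℚ`, absurd). [folklore] -/
private theorem I_mul_sqrt_not_mem_adjoin {q q' : ℕ} (hq : q.Prime) (hq' : q'.Prime) (hne : q ≠ q') :
    Complex.I * (Real.sqrt q' : ℂ) ∉ IntermediateField.adjoin ℚ {Complex.I * (Real.sqrt q : ℂ)} := by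
  intro hmem
  set α : ℂ := Complex.I * (Real.sqrt q : ℂ) with hα
  have hαsq : α * α = -(q : ℂ) := I_mul_sqrt_mul_self q
  have hint : IsIntegral ℚ α := isIntegral_of_mul_self_eq_neg hαsq
  let pb := IntermediateField.adjoin.powerBasis hint
  have hdim : pb.dim ≤ 2 := by
    rw [IntermediateField.adjoin.powerBasis_dim]
    exact natDegree_minpoly_le_two ℚ hαsq
  obtain ⟨f, hfdeg, hf⟩ := pb.exists_eq_aeval ⟨_, hmem⟩
  have hf1 : f.natDegree ≤ 1 := by omega
  have hfe : f = C (f.coeff 1) * X + C (f.coeff 0) := eq_X_add_C_of_natDegree_le_one hf1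
  -- read `⟨i√q', hmem⟩ = aeval gen f` in `ℂ`
  have h1 := congrArg (IntermediateField.val (IntermediateField.adjoin ℚ {α})) hf
  rw [← Polynomial.aeval_algHom_apply] at h1
  have hgen : (IntermediateField.val (IntermediateField.adjoin ℚ {α})) pb.gen = α := by
    rw [IntermediateField.adjoin.powerBasis_gen]
    rfl
  rw [hgen, hfe] at h1
  have hlhs : (IntermediateField.val (IntermediateField.adjoin ℚ {α})) ⟨Complex.I * (Real.sqrt q' : ℂ), hmem⟩ =
      Complex.I * (Real.sqrt q' : ℂ) := rfl
  rw [hlhs] at h1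
  simp only [map_add, map_mul, aeval_C, aeval_X, eq_ratCast] at h1
  -- imaginary parts: `√q' = b·√q` with `b = f.coeff 1 ∈ ℚ`
  have him := congrArg Complex.im h1
  simp only [hα, Complex.mul_im, Complex.I_re, Complex.I_im, Complex.ofReal_re, Complex.ofReal_im,
    Complex.add_im, Complex.ratCast_re, Complex.ratCast_im, Complex.mul_re, zero_mul, one_mul, mul_zero,
    sub_zero, zero_add, add_zero] at him
  -- `him : √q' = b * √q`
  have hsq : Real.sqrt ((q' * q : ℕ) : ℝ) = ((f.coeff 1 * q : ℚ) : ℝ) := by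
    rw [Nat.cast_mul, Real.sqrt_mul (Nat.cast_nonneg q'), him]
    push_cast
    rw [mul_assoc, Real.mul_self_sqrt (Nat.cast_nonneg q)]
  exact (irrational_sqrt_natCast_iff.2 (not_isSquare_mul_of_prime_ne hq hq' hne)) ⟨_, hsq.symm⟩

/-- **A number field inside `ℂ` misses `i√q` for some prime `q`**: it has finitely many subfields (Steinitz, Mathlib
`Field.finite_intermediateField_of_exists_primitive_element`), while the subfields `ℚ(i√q)`, `q` prime, are pairwise
distinct (`I_mul_sqrt_not_mem_adjoin`) and the primes are infinite. [folklore] -/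
private theorem exists_prime_I_mul_sqrt_not_mem (E : IntermediateField ℚ ℂ) [FiniteDimensional ℚ ↥E] :
    ∃ q : ℕ, q.Prime ∧ Complex.I * (Real.sqrt q : ℂ) ∉ E := by
  by_contra hall
  push Not at hall
  haveI : Finite (IntermediateField ℚ ↥E) :=
    Field.finite_intermediateField_of_exists_primitive_element ℚ ↥E (Field.exists_primitive_element ℚ ↥E)
  haveI : Infinite ↥({q : ℕ | q.Prime} : Set ℕ) := Nat.infinite_setOf_prime.to_subtype
  let f : ↥({q : ℕ | q.Prime} : Set ℕ) → IntermediateField ℚ ↥E := fun q =>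
    IntermediateField.adjoin ℚ {(⟨Complex.I * (Real.sqrt (q : ℕ) : ℂ), hall q q.2⟩ : ↥E)}
  obtain ⟨q, q', hne, hfeq⟩ := Finite.exists_ne_map_eq_of_infinite f
  have hmem : (⟨Complex.I * (Real.sqrt (q' : ℕ) : ℂ), hall q' q'.2⟩ : ↥E) ∈ f q := by
    rw [hfeq]
    exact IntermediateField.mem_adjoin_simple_self ℚ _
  have hmemC : Complex.I * (Real.sqrt (q' : ℕ) : ℂ) ∈
      IntermediateField.adjoin ℚ {Complex.I * (Real.sqrt (q : ℕ) : ℂ)} := by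
    have h : E.val ⟨Complex.I * (Real.sqrt (q' : ℕ) : ℂ), hall q' q'.2⟩ ∈ (f q).map E.val :=
      (IntermediateField.mem_map (f q)).2 ⟨_, hmem, rfl⟩
    have hfq : (f q).map E.val = IntermediateField.adjoin ℚ {Complex.I * (Real.sqrt (q : ℕ) : ℂ)} := by
      show (IntermediateField.adjoin ℚ _).map E.val = _
      rw [IntermediateField.adjoin_map, Set.image_singleton]
      rfl
    rw [hfq] at h
    exact h
  exact I_mul_sqrt_not_mem_adjoin q.2 q'.2 (fun h => hne (Subtype.ext h)) hmemC

/-- **A twist pair exists for every `(L, τ)`**: primes `p, q` and square roots `r, r' ∈ ℂ` of `-p, -q` with `r' ∉ τ(L)(r)`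
(here `p = 2`, `r = i√2`, `r' = i√q` for a prime `q` supplied by `exists_prime_I_mul_sqrt_not_mem`) — two members of
[Deligne1979ShimuraVarieties] 2.3.10's family of auxiliary quadratic fields `ℚ(√-p)` whose composita with `τ(L)` meet in
`τ(L)`. [cite: Deligne1979ShimuraVarieties, 2.3.10 (proof, type A; PDF p. 33 of Milne's translation)] -/
theorem exists_prime_sq_roots_not_mem :
    ∃ (p q : ℕ) (r r' : ℂ), p.Prime ∧ q.Prime ∧ r * r = -(p : ℂ) ∧ r' * r' = -(q : ℂ) ∧
      r' ∉ τ.toRatAlgHom.fieldRange ⊔ IntermediateField.adjoin ℚ {r} := by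
  haveI := finiteDimensional_fieldRange_sup_adjoin τ (I_mul_sqrt_mul_self 2)
  obtain ⟨q, hq, hnot⟩ := exists_prime_I_mul_sqrt_not_mem
    (τ.toRatAlgHom.fieldRange ⊔ IntermediateField.adjoin ℚ {Complex.I * (Real.sqrt (2 : ℕ) : ℂ)})
  exact ⟨2, q, _, _, Nat.prime_two, hq, I_mul_sqrt_mul_self 2, I_mul_sqrt_mul_self q, hnot⟩

/-- **The K-twist census pair** (everything the hDel closing step consumes, for ANY number field `L` and `τ`): primes
`p, q`, square roots `r, r'` of `-p, -q`, and the inclusion `τ(L)(r) ∩ τ(L)(r') ⊆ τ(L)` feeding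
`isCanonicalDescentAt_of_descentToIntersection_of_pair`. [cite: Deligne1979ShimuraVarieties, 2.3.10 (i)]
[cite: Deligne1971TravauxShimura, 5.10 (p. 158)] -/
theorem exists_prime_sq_roots_inf_subset_range :
    ∃ (p q : ℕ) (r r' : ℂ), p.Prime ∧ q.Prime ∧ r * r = -(p : ℂ) ∧ r' * r' = -(q : ℂ) ∧
      r' ∉ τ.toRatAlgHom.fieldRange ⊔ IntermediateField.adjoin ℚ {r} ∧
      (((τ.toRatAlgHom.fieldRange ⊔ IntermediateField.adjoin ℚ {r}) ⊓
          (τ.toRatAlgHom.fieldRange ⊔ IntermediateField.adjoin ℚ {r'}) : IntermediateField ℚ ℂ) : Set ℂ) ⊆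
        Set.range τ := by
  obtain ⟨p, q, r, r', hp, hq, hr, hr', hnot⟩ := exists_prime_sq_roots_not_mem τ
  exact ⟨p, q, r, r', hp, hq, hr, hr', hnot, inf_fieldRange_sup_adjoin_subset_range τ hr' hnot⟩

end Literature.NumberTheory.NumberFields

end
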